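/-
Copyright (c) 2026. All rights reserved.
Released under Apache 2.0 license as described in the file LICENSE.
Authors: abc-iut cell, wave-2 seat abc-iut-L3-t10 (gen 3; row «LD-REPAIR» (B): the per-level branch
dictionary with COVERING kernels — statements + glue; after abc-iut-L3-t11's `LevelDictionary`).
-/
import Literature.AnabelianGeometry.SemiGraphs.TemperedLevelDictionary
import Literature.AnabelianGeometry.SemiGraphs.TemperedBranchPairProducerCov
import HarnessLib

/-!
# [SemiAnbd] Thm 3.7 (iii): the per-level branch dictionary with covering kernels — (DV), (DB), (DI), (DN)

Mochizuki, *Semi-graphs of anabelioids*, Publ. RIMS **42** (2006) [MochizukiSemiAnbd2006], Thm 3.7 (iii) pp. 40–41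
with the author's *Comments* (2020), (6)(b) ("converge, in the profinite topology, to some profinite subjoint …
[cf. Remark 2.2.1] … in the profinite fundamental group `π̂₁(G)`"), Remark 2.2.1 p. 24 (images of `Π_v`, `Π_b`
are the stabilisers of the vertex / branch), Definition 2.2 (i) p. 23 (branches over `b` at `v_j` ↔ double
cosets `Π_{v_j}\Π_v/Π_b`).

STATEMENTS + GLUE (cell row «LD-REPAIR» (B), seat abc-iut-L3-t10 gen 3; ruling α5-1 of abc-iut-L3-lead).
abc-iut-L3-t11's `LevelDictionary` (`TemperedLevelDictionary.lean`) packages the producer's deliverable for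
Thm 3.7 (iii) as DATA + four single-level obligations; its fields `isOpen_ker_qAct / ker_qAct_anti /
ker_qAct_trivial` make the open normal subgroups entering the obligations the kernels of the `Q`-actions on the
finite level GRAPHS `𝔾_j` and ask them to meet in `1` — i.e. (with `qAct_ιQ`, `ιQ_injective`) that `π₁^temp(𝒢)`
act faithfully on the system of level graphs. At the intended levels (the underlying graphs of a cofinal tower
of finite étale Galois coverings) this FAILS for every edgeless one-vertex `𝒢` with `Π_v ≠ 1` (all `𝔾_j` are
points; kernel certificate `LevelDictionary.eq_one_of_forall_levelAct` in the sequel) and is an unnecessary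
theorem otherwise. Print's argument uses the kernels `M_j := ker (π̂₁(G) → Gal(𝒢_j/𝒢))` of the COVERINGS, which
meet in `1` because `π̂₁(G)` is their limit. This file is the repaired interface:

* `ProfiniteSemiGraph.CovLevelDictionary 𝒢 c` — `LevelDictionary` with the three kernel fields replaced by an
  antitone family `M j` of open normal subgroups of `Q` meeting in `1`;
* `CovLevelDictionary.DV / DB / DI / DN` — the four obligations (P1)–(P4), verbatim with `M j` for `ker (qAct j)`;
* `CovLevelDictionary.toFiniteLevelData` — the glue to abc-iut-L3-t10's `FiniteLevelData` through
  `stabBranchPair'_of_coveringDictionary` (`TemperedBranchPairProducerCov.lean`);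
* `LevelDictionary.toCov` and `LevelDictionary.toCov_DV/DB/DI/DN` (`Iff.rfl`) — every v1 dictionary is a
  covering dictionary with `M j := ker (qAct j)`, so nothing typed against v1 is lost.

Typed ≠ proved: the four obligations are stated, not discharged, here; the producer (the Galois tower of
`B^temp(𝒢)`, seats abc-iut-L3-t9/t8/t6) builds the data and proves four single-level statements. No instances
beyond the structure-bundled ones (as in `LevelDictionary`), no notation. Nothing here takes a side on
[IUTchIII] Cor. 3.12.
-/

namespace Literature.AnabelianGeometry.SemiGraphs

namespace ProfiniteSemiGraph

open CategoryTheory Topology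
open scoped Pointwise

universe v u

variable {𝒢 : ProfiniteSemiGraph.{u}}

/-- **The per-level branch dictionary data with COVERING kernels** over a chart `c` of `π₁^temp(𝒢)`: the
tree-level data (`VerticialLevelData`), the finite levels `𝔾_j` with their graph-coverings, actions and
transitions (as in `FiniteLevelData`), their structure maps to `𝔾`, a compact Hausdorff overgroup
`ιQ : π₁^temp(𝒢) ↪ Q` acting compatibly on the levels (print: the profinite completion `π̂₁(G)`, Prop. 3.6
(iii)), an antitone family of open normal subgroups `M_j ≤ Q` meeting in `1` (print: the kernels
`ker (π̂₁(G) → Gal(𝒢_j/𝒢))` of the finite étale Galois COVERINGS — NOT the kernels of the actions on the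
graphs `𝔾_j`, which need not meet in `1`: for an edgeless one-vertex `𝒢` every `𝔾_j` is a point), reference
embeddings `ψ_v : Π_v → Q`, and chosen double-coset representatives `rep`. This is abc-iut-L3-t11's
`LevelDictionary` with the three kernel fields replaced by the family `M` (`LevelDictionary.toCov`).
[cite: MochizukiSemiAnbd2006, Rmk. 2.2.1 p.24] -/
structure CovLevelDictionary (𝒢 : ProfiniteSemiGraph.{u}) (c : TemperedPiChart 𝒢)
    extends VerticialLevelData.{v} 𝒢 c where
  /-- the finite semi-graphs `𝔾_j` underlying the finite étale Galois coverings `𝒢_j → 𝒢` -/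
  level : J → SemiGraph.{u}
  [finiteVertex : ∀ j, Finite (level j).Vertex]
  [finiteBranch : ∀ j, Finite (level j).Branch]
  /-- the universal graph-coverings `𝒢_{∞,j} → 𝔾_j` -/
  quot : ∀ j, tree j ⟶ level j
  /-- graph-coverings are immersions -/
  quot_isImmersion : ∀ j, SemiGraph.IsImmersion (quot j)
  /-- the induced actions on the finite levels -/
  levelAct : ∀ j, c.G →* Aut (level j)
  /-- `quot` is equivariant -/
  act_quot : ∀ (j : J) (g : c.G), (act j g).hom ≫ quot j = quot j ≫ (levelAct j g).hom
  /-- the transition morphisms `𝔾_j → 𝔾_i`, `i ≤ j` -/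
  levelTrans : ∀ ⦃i j : J⦄, i ≤ j → (level j ⟶ level i)
  /-- functoriality: identities -/
  levelTrans_id : ∀ j, levelTrans (le_refl j) = 𝟙 (level j)
  /-- functoriality: composition -/
  levelTrans_comp : ∀ ⦃i j k : J⦄ (hij : i ≤ j) (hjk : j ≤ k),
    levelTrans hjk ≫ levelTrans hij = levelTrans (hij.trans hjk)
  /-- the finite-level transition morphisms are equivariant -/
  levelTrans_act : ∀ ⦃i j : J⦄ (h : i ≤ j) (g : c.G),
    (levelAct j g).hom ≫ levelTrans h = levelTrans h ≫ (levelAct i g).hom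
  /-- the transition morphisms of the trees cover those of the finite levels -/
  trans_quot : ∀ ⦃i j : J⦄ (h : i ≤ j), trans h ≫ quot i = quot j ≫ levelTrans h
  /-- the structure maps `𝔾_j → 𝔾` -/
  levelProj : ∀ j, level j ⟶ 𝒢.graph
  /-- the structure maps are compatible with the transitions -/
  levelProj_trans : ∀ ⦃i j : J⦄ (h : i ≤ j), levelTrans h ≫ levelProj i = levelProj j
  /-- the compact overgroup `Q` (print: `π̂₁(G)`) -/
  Q : Type u
  [groupQ : Group Q]
  [topologicalSpaceQ : TopologicalSpace Q]
  [isTopologicalGroupQ : IsTopologicalGroup Q]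
  [compactSpaceQ : CompactSpace Q]
  [t2SpaceQ : T2Space Q]
  /-- `π₁^temp(𝒢) → Q` -/
  ιQ : c.G →* Q
  /-- … is injective (residual finiteness with respect to the finite levels, Prop 3.6 (iii)) -/
  ιQ_injective : Function.Injective ιQ
  /-- the actions of `Q` on the finite levels -/
  qAct : ∀ j, Q →* Aut (level j)
  /-- … extending those of `π₁^temp(𝒢)` -/
  qAct_ιQ : ∀ (j : J) (g : c.G), qAct j (ιQ g) = levelAct j g
  /-- the covering kernels `M_j` (print: `ker (π̂₁(G) → Gal(𝒢_j/𝒢))`, `𝒢_j → 𝒢` the finite étale Galois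
  covering whose underlying semi-graph is `level j`; they are contained in, and in general strictly smaller
  than, the kernels of the actions `qAct j` on the GRAPHS `level j`) -/
  M : J → Subgroup Q
  /-- … normal -/
  M_normal : ∀ j, (M j).Normal
  /-- … open -/
  isOpen_M : ∀ j, IsOpen (M j : Set Q)
  /-- … antitone -/
  M_anti : ∀ ⦃i j : J⦄, i ≤ j → M j ≤ M i
  /-- … and meet in `1` (`Q` is the completion with respect to the coverings `𝒢_j`) -/
  M_trivial : ∀ q : Q, (∀ j, q ∈ M j) → q = 1
  /-- the `Q`-actions are compatible with the transitions (on vertices) -/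
  qAct_trans : ∀ ⦃i j : J⦄ (h : i ≤ j) (q : Q) (x : (level j).Vertex),
    (levelTrans h).vertexMap ((qAct j q).hom.vertexMap x) = (qAct i q).hom.vertexMap ((levelTrans h).vertexMap x)
  /-- the reference embeddings `ψ_v : Π_v → Q` -/
  ψ : ∀ v : 𝒢.graph.Vertex, 𝒢.Gv v →* Q
  /-- … injective -/
  ψ_injective : ∀ v, Function.Injective (ψ v)
  /-- … continuous -/
  ψ_continuous : ∀ v, Continuous (ψ v)
  /-- chosen double-coset representatives `y_β ∈ Π_v` of the branches of the finite levels -/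
  rep : ∀ (j : J) (_ : (level j).Vertex) (v : 𝒢.graph.Vertex) (_ : Q) (_ : (level j).Branch), 𝒢.Gv v

attribute [instance] CovLevelDictionary.finiteVertex CovLevelDictionary.finiteBranch CovLevelDictionary.groupQ
  CovLevelDictionary.topologicalSpaceQ CovLevelDictionary.isTopologicalGroupQ CovLevelDictionary.compactSpaceQ
  CovLevelDictionary.t2SpaceQ

namespace CovLevelDictionary

variable {c : TemperedPiChart 𝒢} (X : CovLevelDictionary.{v} 𝒢 c)

/-- **(P1) = (DV), vertex stabilisers** (Remark 2.2.1 for vertices, one finite level): the `Q`-stabiliser of a vertex `w` of `𝔾_j` over `v` is `γ·ψ_v(Π_v)·γ⁻¹·M_j` for some `γ ∈ Q`. [cite: MochizukiSemiAnbd2006, Rmk. 2.2.1 p.24] -/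
def DV : Prop :=
  ∀ (j : X.J) (w : (X.level j).Vertex) (v : 𝒢.graph.Vertex), (X.levelProj j).vertexMap w = v →
      ∃ γ : X.Q, ∀ q : X.Q, (X.qAct j q).hom.vertexMap w = w ↔
        q ∈ ((X.ψ v).range.map (MulAut.conj γ).toMonoidHom) ⊔ X.M j

/-- **(P2) = (DB), branch stabilisers** (Remark 2.2.1 for branches, one finite level): for `γ` as in (DV), the `Q`-stabiliser of `(w, β)`, `β` a branch at `w` over `b`, is `γ·ψ_v(y·Π_b·y⁻¹)·γ⁻¹·M_j` with `y = rep j w v γ β`. [cite: MochizukiSemiAnbd2006, Rmk. 2.2.1 p.24] -/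
def DB : Prop :=
  ∀ (j : X.J) (w : (X.level j).Vertex) (v : 𝒢.graph.Vertex) (_ : (X.levelProj j).vertexMap w = v) (γ : X.Q),
      (∀ q : X.Q, (X.qAct j q).hom.vertexMap w = w ↔ q ∈ ((X.ψ v).range.map (MulAut.conj γ).toMonoidHom) ⊔ X.M j) →
      ∀ (β : (X.level j).Branch) (_ : (X.level j).abuts β = some w) (b : 𝒢.graph.Branch)
        (_ : (X.levelProj j).branchMap β = b) (hb : 𝒢.graph.abuts b = some v),
        ∀ q : X.Q, ((X.qAct j q).hom.vertexMap w = w ∧ (X.qAct j q).hom.branchMap β = β) ↔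
          q ∈ (((𝒢.branchSubgroup b v hb).map (MulAut.conj (X.rep j w v γ β)).toMonoidHom).map (X.ψ v)).map
            (MulAut.conj γ).toMonoidHom ⊔ X.M j

/-- **(P3) = (DI), injectivity of the branch dictionary** (Definition 2.2 (i), one finite level): distinct branches at `w` over the same `b` have distinct double cosets `M̃_j·y·Π_b` (`M̃_j` the level inside `Π_v`). [cite: MochizukiSemiAnbd2006, Def. 2.2(i) p.23] -/
def DI : Prop :=
  ∀ (j : X.J) (w : (X.level j).Vertex) (v : 𝒢.graph.Vertex) (_ : (X.levelProj j).vertexMap w = v) (γ : X.Q),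
      (∀ q : X.Q, (X.qAct j q).hom.vertexMap w = w ↔ q ∈ ((X.ψ v).range.map (MulAut.conj γ).toMonoidHom) ⊔ X.M j) →
      ∀ (β β' : (X.level j).Branch), (X.level j).abuts β = some w → (X.level j).abuts β' = some w →
        ∀ (b : 𝒢.graph.Branch) (hb : 𝒢.graph.abuts b = some v),
        (X.levelProj j).branchMap β = b → (X.levelProj j).branchMap β' = b → β ≠ β' →
        X.rep j w v γ β' ∉ (((X.M j).comap ((MulAut.conj γ).toMonoidHom.comp (X.ψ v)) : Subgroup (𝒢.Gv v)) :
          Set (𝒢.Gv v)) * {X.rep j w v γ β} * (𝒢.branchSubgroup b v hb : Set (𝒢.Gv v))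

/-- **(P4) = (DN), naturality of the branch dictionary** (Definition 2.2 (i) under a transition `𝔾_j → 𝔾_i`): the representative of `β` lies in the level-`i` double coset of the image branch. [cite: MochizukiSemiAnbd2006, Def. 2.2(i) p.23] -/
def DN : Prop :=
  ∀ ⦃i j : X.J⦄ (h : i ≤ j) (w : (X.level j).Vertex) (v : 𝒢.graph.Vertex) (_ : (X.levelProj j).vertexMap w = v)
      (γ : X.Q),
      (∀ q : X.Q, (X.qAct j q).hom.vertexMap w = w ↔ q ∈ ((X.ψ v).range.map (MulAut.conj γ).toMonoidHom) ⊔ X.M j) →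
      (∀ q : X.Q, (X.qAct i q).hom.vertexMap ((X.levelTrans h).vertexMap w) = (X.levelTrans h).vertexMap w ↔
        q ∈ ((X.ψ v).range.map (MulAut.conj γ).toMonoidHom) ⊔ X.M i) →
      ∀ (β : (X.level j).Branch), (X.level j).abuts β = some w → ∀ (b : 𝒢.graph.Branch)
        (hb : 𝒢.graph.abuts b = some v), (X.levelProj j).branchMap β = b →
        X.rep j w v γ β ∈ (((X.M i).comap ((MulAut.conj γ).toMonoidHom.comp (X.ψ v)) : Subgroup (𝒢.Gv v)) :
          Set (𝒢.Gv v)) * {X.rep i ((X.levelTrans h).vertexMap w) v γ ((X.levelTrans h).branchMap β)} *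
            (𝒢.branchSubgroup b v hb : Set (𝒢.Gv v))

/-- **The glue**: a level dictionary with covering kernels satisfying the four obligations yields
abc-iut-L3-t10's `FiniteLevelData` — the identification (I4′) `stabBranchPair'` being
`stabBranchPair'_of_coveringDictionary` — and hence, through `FiniteLevelData`, both conjuncts of
`CompactInVerticial` (sequel `TemperedCompactInVerticialOfCovDictionary.lean`). [cite: MochizukiSemiAnbd2006, Thm 3.7(iii) p.41] -/
noncomputable def toFiniteLevelData (h₁ : X.DV) (h₂ : X.DB) (h₃ : X.DI) (h₄ : X.DN) :
    FiniteLevelData.{v} 𝒢 c where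
  toVerticialLevelData := X.toVerticialLevelData
  level := X.level
  quot := X.quot
  quot_isImmersion := X.quot_isImmersion
  levelAct := X.levelAct
  act_quot := X.act_quot
  levelTrans := X.levelTrans
  levelTrans_id := X.levelTrans_id
  levelTrans_comp := X.levelTrans_comp
  levelTrans_act := X.levelTrans_act
  trans_quot := X.trans_quot
  stabBranchPair' :=
    stabBranchPair'_of_coveringDictionary c X.level X.levelAct X.levelTrans X.levelProj X.levelProj_trans X.Q
      X.ιQ X.ιQ_injective X.qAct X.qAct_ιQ X.M X.M_normal X.isOpen_M X.M_anti X.M_trivial X.qAct_trans X.ψ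
      X.ψ_injective X.ψ_continuous X.rep h₁ h₂ h₃ h₄


end CovLevelDictionary

/-! ### Every v1 dictionary is a covering dictionary -/

namespace LevelDictionary

variable {c : TemperedPiChart 𝒢} (X : LevelDictionary.{v} 𝒢 c)

/-- A `LevelDictionary` (kernels of the graph actions) is a `CovLevelDictionary` with `M j := ker (qAct j)`.
[cite: MochizukiSemiAnbd2006, Rmk. 2.2.1 p.24] -/
def toCov : CovLevelDictionary.{v} 𝒢 c where
  toVerticialLevelData := X.toVerticialLevelData
  level := X.level
  quot := X.quot
  quot_isImmersion := X.quot_isImmersion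
  levelAct := X.levelAct
  act_quot := X.act_quot
  levelTrans := X.levelTrans
  levelTrans_id := X.levelTrans_id
  levelTrans_comp := X.levelTrans_comp
  levelTrans_act := X.levelTrans_act
  trans_quot := X.trans_quot
  levelProj := X.levelProj
  levelProj_trans := X.levelProj_trans
  Q := X.Q
  ιQ := X.ιQ
  ιQ_injective := X.ιQ_injective
  qAct := X.qAct
  qAct_ιQ := X.qAct_ιQ
  M j := (X.qAct j).ker
  M_normal _ := inferInstance
  isOpen_M := X.isOpen_ker_qAct
  M_anti := X.ker_qAct_anti
  M_trivial := X.ker_qAct_trivial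
  qAct_trans := X.qAct_trans
  ψ := X.ψ
  ψ_injective := X.ψ_injective
  ψ_continuous := X.ψ_continuous
  rep := X.rep

/-- (DV) is the same statement for `X` and `X.toCov`. [cite: MochizukiSemiAnbd2006, Rmk. 2.2.1 p.24] -/
theorem toCov_DV : X.toCov.DV ↔ X.DV := Iff.rfl

/-- (DB) is the same statement for `X` and `X.toCov`. [cite: MochizukiSemiAnbd2006, Rmk. 2.2.1 p.24] -/
theorem toCov_DB : X.toCov.DB ↔ X.DB := Iff.rfl

/-- (DI) is the same statement for `X` and `X.toCov`. [cite: MochizukiSemiAnbd2006, Def. 2.2(i) p.23] -/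
theorem toCov_DI : X.toCov.DI ↔ X.DI := Iff.rfl

/-- (DN) is the same statement for `X` and `X.toCov`. [cite: MochizukiSemiAnbd2006, Def. 2.2(i) p.23] -/
theorem toCov_DN : X.toCov.DN ↔ X.DN := Iff.rfl

end LevelDictionary

end ProfiniteSemiGraph

end Literature.AnabelianGeometry.SemiGraphs
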